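import Literature.Analysis.Complex.PlancherelPolyaSubMean
import Mathlib.Analysis.Complex.PhragmenLindelof
import Mathlib.Analysis.Calculus.Deriv.Star
import HarnessLib

/-!
# Young 2001, Ch. 2 §3, Lemmas 1 and 2 (Phragmén–Lindelöf for Plancherel–Pólya functionals)

Literature/Analysis/Complex. R. M. Young, *An Introduction to Nonharmonic Fourier Series* (rev. 1st
ed., 2001), Ch. 2 §3, the two preliminary lemmas of the "elementary" Plancherel–Pólya [1938] proof
of Thm. 16, for the functional `G (z) = ∫ |g (z + t)|^p dt` of an ENTIRE function `g` of exponential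
type (`|g (z)| ≤ A e^{B|z|}`; the book states them for `g` of exponential type in `Im z ≥ 0`, the
entire case is what Thm. 16 uses):

* `quadrant_I_ppFun`, `quadrant_II_ppFun`, `upperHalfPlane_ppFun` — **Lemma 1**: `G ≤ K` on the real
  axis and on the positive imaginary axis implies `G ≤ K` on the closed upper half-plane
  (the book's `max (M, N)` is any common bound `K`);
* `imAxis_ppFun_le` — **Lemma 2**: if moreover `G (iy) → 0` as `y → ∞`, the real-axis bound alone
  bounds `G` on the positive imaginary axis (`N ≤ M`).

Design choice (recorded in the docstring of `quadrant_I_ppFun`): the quadrant Phragmén–Lindelöf step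
is carried out in logarithmic coordinates with Mathlib's entire damping factor from
`PhragmenLindelof.horizontal_strip` rather than the printed branch of `(λ (z + a))^{3/2}`; everything
else follows the printed argument. Deliberately NOT here: Thm. 16 itself (`PlancherelPolyaProofs.lean`).

## References
* R. M. Young, *An Introduction to Nonharmonic Fourier Series*, rev. 1st ed., Academic Press 2001,
  Ch. 2 §3, Lemmas 1–2. (key `Young2001Nonharmonic`)
* M. Plancherel, G. Pólya, *Fonctions entières et intégrales de Fourier multiples* II, Comment.
  Math. Helv. 10 (1937/38), 110–163.
-/

noncomputable section

open Complex MeasureTheory Real Set Metric Filter Topology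
open scoped Interval ComplexConjugate

namespace Literature.Analysis.Complex

namespace PlancherelPolya

/-! ### Growth of the functional and the quadrant Phragmén–Lindelöf principle (Young's Lemma 1) -/

/-- Growth of the Plancherel–Pólya functional of a function of exponential type:
`∫_{t₁}^{t₂} ‖g (z + t)‖ ^ p dt ≤ (t₂ - t₁) (A e^{B max(|t₁|,|t₂|)})^p e^{p B ‖z‖}` when
`‖g w‖ ≤ A e^{B ‖w‖}`. [folklore] -/
theorem ppFun_growth {g : ℂ → ℂ} (hgc : Continuous g) {A B : ℝ} (hA : 0 ≤ A) (hB : 0 ≤ B)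
    (hg : ∀ z, ‖g z‖ ≤ A * Real.exp (B * ‖z‖)) {p : ℝ} (hp : 0 < p) {t₁ t₂ : ℝ} (ht : t₁ ≤ t₂)
    (z : ℂ) :
    ∫ t in t₁..t₂, ‖g (z + t)‖ ^ p
      ≤ (t₂ - t₁) * (A * Real.exp (B * max |t₁| |t₂|)) ^ p * Real.exp (p * B * ‖z‖) := by
  set T := max |t₁| |t₂|
  have hpt : ∀ t ∈ Icc t₁ t₂,
      ‖g (z + t)‖ ^ p ≤ (A * Real.exp (B * T)) ^ p * Real.exp (p * B * ‖z‖) := by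
    intro t htI
    have h1 : ‖(t : ℂ)‖ ≤ T := by
      rw [norm_real, Real.norm_eq_abs]
      exact abs_le_max_abs_abs htI.1 htI.2
    have h2 : ‖g (z + t)‖ ≤ A * Real.exp (B * T) * Real.exp (B * ‖z‖) := by
      calc ‖g (z + t)‖ ≤ A * Real.exp (B * ‖z + t‖) := hg _
        _ ≤ A * Real.exp (B * (‖z‖ + T)) := by
            gcongr
            exact (norm_add_le _ _).trans (by linarith)
        _ = A * Real.exp (B * T) * Real.exp (B * ‖z‖) := by rw [mul_add, Real.exp_add]; ring
    have h3 : Real.exp (B * ‖z‖) ^ p = Real.exp (p * B * ‖z‖) := by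
      rw [← Real.exp_mul]; congr 1; ring
    calc ‖g (z + t)‖ ^ p ≤ (A * Real.exp (B * T) * Real.exp (B * ‖z‖)) ^ p :=
          Real.rpow_le_rpow (norm_nonneg _) h2 hp.le
      _ = (A * Real.exp (B * T)) ^ p * Real.exp (p * B * ‖z‖) := by
          rw [Real.mul_rpow (by positivity) (Real.exp_pos _).le, h3]
  calc ∫ t in t₁..t₂, ‖g (z + t)‖ ^ p
      ≤ ∫ t in t₁..t₂, (A * Real.exp (B * T)) ^ p * Real.exp (p * B * ‖z‖) := by
        apply intervalIntegral.integral_mono_on ht _ _ hpt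
        · exact ((hgc.comp (continuous_const.add continuous_ofReal)).norm.rpow_const
            fun _ => Or.inr hp.le).intervalIntegrable _ _
        · exact _root_.intervalIntegrable_const
    _ = (t₂ - t₁) * ((A * Real.exp (B * T)) ^ p * Real.exp (p * B * ‖z‖)) := by
        rw [intervalIntegral.integral_const, smul_eq_mul]
    _ = _ := by ring

/-- The decay estimate behind the choice of the rectangle in the Phragmén–Lindelöf argument
(extracted from the proof of `PhragmenLindelof.horizontal_strip` in Mathlib): for `δ < 0` and
`1 < d`, `exp (δ e^{dρ} + P e^{ρ}) → 0` as `ρ → ∞`. [folklore] -/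
theorem tendsto_exp_damping {δ d P : ℝ} (hδ : δ < 0) (hd : 1 < d) :
    Tendsto (fun ρ : ℝ => Real.exp (δ * Real.exp (d * ρ) + P * Real.exp (1 * ρ))) atTop (𝓝 0) := by
  refine Real.tendsto_exp_atBot.comp ?_
  have hd₀ : 0 < d := one_pos.trans hd
  suffices H : Tendsto (fun ρ => δ + P * (Real.exp ((d - 1) * ρ))⁻¹) atTop (𝓝 (δ + P * 0)) by
    rw [mul_zero, add_zero] at H
    simpa only [id, (· ∘ ·), add_mul, mul_assoc, ← div_eq_inv_mul, ← Real.exp_sub, ← sub_mul,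
      sub_sub_cancel]
      using H.neg_mul_atTop hδ <| Real.tendsto_exp_atTop.comp <| tendsto_id.const_mul_atTop hd₀
  refine tendsto_const_nhds.add (tendsto_const_nhds.mul ?_)
  exact tendsto_inv_atTop_zero.comp <| Real.tendsto_exp_atTop.comp <|
    tendsto_id.const_mul_atTop (sub_pos.2 hd)

/-- **Young's Lemma 1 (first quadrant).** Phragmén–Lindelöf principle for the Plancherel–Pólya
functional `u(z) = ∫_{t₁}^{t₂} ‖g(z+t)‖^p dt` of an entire function `g` of exponential type: if
`u ≤ K` on both boundary rays of the closed first quadrant, then `u ≤ K` throughout it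
("Let `g` be of exponential type in the half-plane … `G(z) ≤ max (M, N)`", printed for
`[t₁, t₂] = [-a, a]`). Deviation from the printed proof: the damping is done in logarithmic
coordinates `z = e^ζ`, `0 ≤ Im ζ ≤ π/2`, with Mathlib's entire factor `exp (ε (e^{ζ'} + e^{-ζ'}))`
(`ζ' = 3/2 (ζ - iπ/4)`, `ε < 0`) exactly as in `PhragmenLindelof.horizontal_strip`, instead of the
printed `exp (-ε (λ (z + a))^{3/2})`; the damped functional is again a Plancherel–Pólya functional
of an entire family, and the weak maximum principle `le_on_closure_of_le_on_frontier` is applied on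
rectangles. [cite: Young2001Nonharmonic, Ch. 2 §3 Lemma 1] -/
theorem quadrant_I_ppFun {g : ℂ → ℂ} (hgd : Differentiable ℂ g) {A B : ℝ} (hA : 0 ≤ A)
    (hB : 0 ≤ B) (hg : ∀ z, ‖g z‖ ≤ A * Real.exp (B * ‖z‖)) {p : ℝ} (hp : 0 < p) {t₁ t₂ : ℝ}
    (ht : t₁ ≤ t₂) {u : ℂ → ℝ} (hu : ∀ z, u z = ∫ t in t₁..t₂, ‖g (z + t)‖ ^ p) {K : ℝ}
    (hre : ∀ x : ℝ, 0 ≤ x → u x ≤ K) (him : ∀ y : ℝ, 0 ≤ y → u (y * I) ≤ K) {z : ℂ}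
    (hz_re : 0 ≤ z.re) (hz_im : 0 ≤ z.im) : u z ≤ K := by
  -- The case `z = 0` is trivial.
  rcases eq_or_ne z 0 with (rfl | hzne)
  · exact_mod_cast hre 0 le_rfl
  -- Otherwise, `z = e ^ ζ` for some `ζ : ℂ`, `0 ≤ Im ζ ≤ π / 2`.
  obtain ⟨ζ, hζ, rfl⟩ : ∃ ζ : ℂ, ζ.im ∈ Icc 0 (π / 2) ∧ exp ζ = z := by
    refine ⟨log z, ?_, exp_log hzne⟩
    rw [log_im]
    exact ⟨arg_nonneg_iff.2 hz_im, arg_le_pi_div_two_iff.2 (Or.inl hz_re)⟩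
  clear hz_re hz_im hzne
  -- nonnegativity of `u` and reduction to `K' > K`
  have hu0 : ∀ w, 0 ≤ u w := fun w => by
    rw [hu]; exact intervalIntegral.integral_nonneg ht fun t _ => by positivity
  have hK0 : 0 ≤ K := (hu0 _).trans (by exact_mod_cast hre 0 le_rfl)
  refine le_of_forall_gt_imp_ge_of_dense fun K' hK' => ?_
  have hK'0 : 0 < K' := hK0.trans_lt hK'
  -- the damping factor (Mathlib's, in the strip `0 ≤ im ≤ π / 2`)
  set d : ℝ := 3 / 2 with hd_def
  have hd₀ : 0 < d := by norm_num
  have hd₁ : 1 < d := by norm_num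
  have hdb : d * (π / 4) < π / 2 := by nlinarith [Real.pi_pos]
  set aff : ℂ → ℂ := fun w => (d : ℂ) * (w - (π / 4 : ℝ) * I) with haff
  set D : ℝ → ℂ → ℂ := fun ε w => exp (ε * (exp (aff w) + exp (-aff w))) with hD
  have haff_im : ∀ w : ℂ, (aff w).im = d * (w.im - π / 4) := fun w => by
    simp [haff, mul_comm]
  have haff_re : ∀ w : ℂ, (aff w).re = d * w.re := fun w => by simp [haff]
  have hDd : ∀ ε : ℝ, Differentiable ℂ (D ε) := fun ε =>
    ((((differentiable_id.sub_const _).const_mul _).cexp.add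
      ((differentiable_id.sub_const _).const_mul _).neg.cexp).const_mul _).cexp
  -- norm estimate for the damping factor
  set δ₀ : ℝ := Real.cos (d * (π / 4)) with hδ₀
  have hδ₀pos : 0 < δ₀ := Real.cos_pos_of_mem_Ioo ⟨by nlinarith [Real.pi_pos], hdb⟩
  have hDle : ∀ ε : ℝ, ε ≤ 0 → ∀ w : ℂ, w.im ∈ Icc 0 (π / 2) →
      ‖D ε w‖ ≤ Real.exp (ε * δ₀ * Real.exp (d * |w.re|)) := by
    intro ε hε w hw
    have h1 : |(aff w).im| ≤ d * (π / 4) := by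
      rw [haff_im, abs_mul, abs_of_pos hd₀]
      refine mul_le_mul_of_nonneg_left (abs_le.2 ⟨?_, ?_⟩) hd₀.le <;> linarith [hw.1, hw.2]
    have := norm_exp_mul_exp_add_exp_neg_le_of_abs_im_le hε h1 hdb.le
    simpa only [hD, haff_re, abs_mul, abs_of_pos hd₀] using this
  have hDle1 : ∀ ε : ℝ, ε ≤ 0 → ∀ w : ℂ, w.im ∈ Icc 0 (π / 2) → ‖D ε w‖ ≤ 1 := by
    intro ε hε w hw
    refine (hDle ε hε w hw).trans (Real.exp_le_one_iff.2 ?_)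
    exact mul_nonpos_of_nonpos_of_nonneg (mul_nonpos_of_nonpos_of_nonneg hε hδ₀pos.le)
      (Real.exp_pos _).le
  -- it suffices to bound the damped functional for every `ε < 0`
  suffices ∀ᶠ ε : ℝ in 𝓝[<] (0 : ℝ), ‖D ε ζ‖ * u (exp ζ) ≤ K' by
    refine le_of_tendsto (Tendsto.mono_left ?_ nhdsWithin_le_nhds) this
    have hc : Continuous fun ε : ℝ => ‖D ε ζ‖ * u (exp ζ) :=
      ((continuous_ofReal.mul continuous_const).cexp.norm.mul continuous_const)
    simpa [hD] using hc.tendsto 0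
  filter_upwards [self_mem_nhdsWithin] with ε ε₀; change ε < 0 at ε₀
  -- the damped functional is again a Plancherel–Pólya functional of an entire family
  set H : ℂ → ℝ → ℂ := fun w t => D (ε / p) w * g (exp w + t) with hH
  set v : ℂ → ℝ := fun w => ∫ t in t₁..t₂, ‖H w t‖ ^ p with hv
  have hHc : Continuous (Function.uncurry H) := by
    refine ((hDd (ε / p)).continuous.comp continuous_fst).mul
      (hgd.continuous.comp ((Complex.continuous_exp.comp continuous_fst).add
        (continuous_ofReal.comp continuous_snd)))
  have hHd : ∀ t, Differentiable ℂ fun w => H w t := fun t =>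
    (hDd (ε / p)).mul (hgd.comp (differentiable_exp.add_const _))
  have hvu : ∀ w, v w = ‖D ε w‖ * u (exp w) := by
    intro w
    have h1 : ‖D (ε / p) w‖ ^ p = ‖D ε w‖ := by
      simp only [hD, norm_exp, ← Real.exp_mul, re_ofReal_mul]
      congr 1
      field_simp
    simp only [hv, hH, norm_mul, Real.mul_rpow (norm_nonneg _) (norm_nonneg _), h1, hu,
      intervalIntegral.integral_const_mul]
  have hvc : Continuous v := continuous_ppFun hHc hp t₁ t₂
  have hvsub : ∀ w : ℂ, ∀ r : ℝ, 0 < r → v w ≤ circleAverage v w r := fun w r hr =>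
    ppFun_le_circleAverage hHc hHd hp ht (fun _ => rfl) w hr
  -- growth: choose the width `R` of the rectangle
  set C₁ : ℝ := (t₂ - t₁) * (A * Real.exp (B * max |t₁| |t₂|)) ^ p with hC₁
  have hC₁0 : 0 ≤ C₁ := by positivity
  have hgrowth : ∀ w : ℂ, u (exp w) ≤ C₁ * Real.exp (p * B * Real.exp (1 * |w.re|)) := by
    intro w
    rw [hu]
    refine (ppFun_growth hgd.continuous hA hB hg hp ht (exp w)).trans ?_
    rw [one_mul, norm_exp]
    gcongr
    exact le_abs_self _
  obtain ⟨R, hζR, hR⟩ : ∃ R : ℝ, |ζ.re| < R ∧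
      ∀ w : ℂ, |w.re| = R → w.im ∈ Icc 0 (π / 2) → v w ≤ K' := by
    have hlim := (tendsto_exp_damping (P := p * B) (mul_neg_of_neg_of_pos ε₀ hδ₀pos) hd₁).const_mul C₁
    rw [mul_zero] at hlim
    obtain ⟨R, hζR, hRK⟩ :=
      ((eventually_gt_atTop |ζ.re|).and (hlim.eventually (ge_mem_nhds hK'0))).exists
    refine ⟨R, hζR, fun w hwre hwim => ?_⟩
    rw [hvu]
    calc ‖D ε w‖ * u (exp w)
        ≤ Real.exp (ε * δ₀ * Real.exp (d * |w.re|)) * (C₁ * Real.exp (p * B * Real.exp (1 * |w.re|))) :=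
          mul_le_mul (hDle ε ε₀.le w hwim) (hgrowth w) (hu0 _) (Real.exp_pos _).le
      _ = C₁ * Real.exp (ε * δ₀ * Real.exp (d * R) + p * B * Real.exp (1 * R)) := by
          rw [hwre, Real.exp_add]; ring
      _ ≤ K' := hRK
  have hR₀ : 0 < R := (abs_nonneg _).trans_lt hζR
  -- the weak maximum principle on the rectangle `(-R, R) × (0, π / 2)`
  have hπ2 : (0 : ℝ) < π / 2 := by positivity
  set V : Set ℂ := Ioo (-R) R ×ℂ Ioo 0 (π / 2) with hV
  have hVo : IsOpen V := isOpen_Ioo.reProdIm isOpen_Ioo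
  have hVconv : Convex ℝ V := convexHull_eq_self.1 (by
    rw [hV, convexHull_reProdIm, (convex_Ioo _ _).convexHull_eq, (convex_Ioo _ _).convexHull_eq])
  have hVb : Bornology.IsBounded V := (Metric.isBounded_Ioo _ _).reProdIm (Metric.isBounded_Ioo _ _)
  have hfr : frontier V = Icc (-R) R ×ℂ {0, π / 2} ∪ {-R, R} ×ℂ Icc 0 (π / 2) := by
    rw [hV, frontier_reProdIm, closure_Ioo (neg_lt_self hR₀).ne, frontier_Ioo hπ2,
      closure_Ioo hπ2.ne, frontier_Ioo (neg_lt_self hR₀)]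
  have hz₂ : (0 : ℂ) ∈ frontier V := by
    rw [hfr]
    exact Or.inl ⟨⟨by simp [hR₀.le], by simp [hR₀.le]⟩, by simp⟩
  have hK'fr : ∀ w ∈ frontier V, v w ≤ K' := by
    intro w hw
    rw [hfr] at hw
    rcases hw with ⟨hwre, hwim⟩ | ⟨hwre, hwim⟩ <;>
      simp only [mem_preimage, mem_insert_iff, mem_singleton_iff] at hwre hwim
    · -- horizontal sides: the damping factor has norm `≤ 1` and `u ≤ K` there
      have hwim' : w.im ∈ Icc 0 (π / 2) := by
        rcases hwim with h | h <;> rw [h]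
        exacts [⟨le_rfl, hπ2.le⟩, ⟨hπ2.le, le_rfl⟩]
      rw [hvu]
      calc ‖D ε w‖ * u (exp w) ≤ 1 * K := by
            refine mul_le_mul (hDle1 ε ε₀.le w hwim') ?_ (hu0 _) zero_le_one
            rcases hwim with h | h
            · -- `exp w` is a positive real number
              have : exp w = (Real.exp w.re : ℝ) := by
                conv_lhs => rw [← re_add_im w]
                rw [h]; simp
              rw [this]; exact hre _ (Real.exp_pos _).le
            · -- `exp w` is purely imaginary with positive imaginary part
              have : exp w = (Real.exp w.re : ℝ) * I := by
                conv_lhs => rw [← re_add_im w]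
                rw [h, exp_add_mul_I, ← ofReal_cos, ← ofReal_sin, Real.cos_pi_div_two,
                  Real.sin_pi_div_two]
                simp
              rw [this]; exact him _ (Real.exp_pos _).le
        _ ≤ K' := by rw [one_mul]; exact hK'.le
    · -- vertical sides: by the choice of `R`
      refine hR w ?_ hwim
      rcases hwre with h | h <;> rw [h]
      exacts [by rw [abs_neg, abs_of_pos hR₀], abs_of_pos hR₀]
  have hζV : ζ ∈ closure V := by
    rw [hV, closure_reProdIm, closure_Ioo (neg_lt_self hR₀).ne, closure_Ioo hπ2.ne]
    exact ⟨abs_lt.1 hζR |>.imp le_of_lt le_of_lt, hζ⟩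
  have := le_on_closure_of_le_on_frontier hvc hvsub hVo hVconv.isPreconnected hVb hz₂ hK'fr ζ hζV
  rwa [hvu] at this

/-- **Young's Lemma 1 (second quadrant)** ("the proof for the second quadrant is the same"),
obtained here from `quadrant_I_ppFun` by the reflection `g ↦ conj ∘ g ∘ (-conj)`.
[cite: Young2001Nonharmonic, Ch. 2 §3 Lemma 1] -/
theorem quadrant_II_ppFun {g : ℂ → ℂ} (hgd : Differentiable ℂ g) {A B : ℝ} (hA : 0 ≤ A)
    (hB : 0 ≤ B) (hg : ∀ z, ‖g z‖ ≤ A * Real.exp (B * ‖z‖)) {p : ℝ} (hp : 0 < p) {t₁ t₂ : ℝ}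
    (ht : t₁ ≤ t₂) {u : ℂ → ℝ} (hu : ∀ z, u z = ∫ t in t₁..t₂, ‖g (z + t)‖ ^ p) {K : ℝ}
    (hre : ∀ x : ℝ, x ≤ 0 → u x ≤ K) (him : ∀ y : ℝ, 0 ≤ y → u (y * I) ≤ K) {z : ℂ}
    (hz_re : z.re ≤ 0) (hz_im : 0 ≤ z.im) : u z ≤ K := by
  set g₂ : ℂ → ℂ := fun z => conj (g (-conj z)) with hg₂
  have hg₂d : Differentiable ℂ g₂ := by
    intro x
    have h1 : DifferentiableAt ℂ (fun w => g (-w)) (conj x) :=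
      (hgd.comp differentiable_neg).differentiableAt
    have h2 := h1.conj_conj
    rw [conj_conj] at h2
    exact h2
  have hg₂b : ∀ z, ‖g₂ z‖ ≤ A * Real.exp (B * ‖z‖) := fun z => by
    simpa [hg₂, norm_conj] using hg (-conj z)
  set u₂ : ℂ → ℝ := fun z => u (-conj z) with hu₂
  have hu₂' : ∀ z, u₂ z = ∫ t in (-t₂)..(-t₁), ‖g₂ (z + t)‖ ^ p := by
    intro z
    simp only [hu₂, hu, hg₂]
    rw [← intervalIntegral.integral_comp_neg]
    simp [add_comm]
  have key := quadrant_I_ppFun hg₂d hA hB hg₂b hp (neg_le_neg ht) hu₂' (K := K)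
    (fun x hx => by simpa [hu₂] using hre (-x) (neg_nonpos.2 hx))
    (fun y hy => by simpa [hu₂] using him y hy)
    (z := -conj z) (by simpa using hz_re) (by simpa using hz_im)
  simpa [hu₂] using key

/-- **Young's Lemma 1** (both quadrants): if the Plancherel–Pólya functional of an entire
function of exponential type is `≤ K` on the real axis and on the positive imaginary axis, then it
is `≤ K` on the closed upper half-plane. [cite: Young2001Nonharmonic, Ch. 2 §3 Lemma 1] -/
theorem upperHalfPlane_ppFun {g : ℂ → ℂ} (hgd : Differentiable ℂ g) {A B : ℝ} (hA : 0 ≤ A)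
    (hB : 0 ≤ B) (hg : ∀ z, ‖g z‖ ≤ A * Real.exp (B * ‖z‖)) {p : ℝ} (hp : 0 < p) {t₁ t₂ : ℝ}
    (ht : t₁ ≤ t₂) {u : ℂ → ℝ} (hu : ∀ z, u z = ∫ t in t₁..t₂, ‖g (z + t)‖ ^ p) {K : ℝ}
    (hre : ∀ x : ℝ, u x ≤ K) (him : ∀ y : ℝ, 0 ≤ y → u (y * I) ≤ K) {z : ℂ}
    (hz_im : 0 ≤ z.im) : u z ≤ K := by
  rcases le_total 0 z.re with h | h
  · exact quadrant_I_ppFun hgd hA hB hg hp ht hu (fun x _ => hre x) him h hz_im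
  · exact quadrant_II_ppFun hgd hA hB hg hp ht hu (fun x _ => hre x) him h hz_im

/-- **Young's Lemma 2**: if moreover the functional tends to zero along the positive imaginary
axis, then its bound `M` on the real axis bounds it on the positive imaginary axis (`N ≤ M`): the
supremum along the imaginary axis is attained at a finite `y₀`, and if `y₀ > 0` the strong maximum
principle (`eqOn_of_isMaxOn_of_le_circleAverage`, with Lemma 1 supplying the global bound) would
make the functional constant on the open upper half-plane, contradicting the decay.
[cite: Young2001Nonharmonic, Ch. 2 §3 Lemma 2] -/
theorem imAxis_ppFun_le {g : ℂ → ℂ} (hgd : Differentiable ℂ g) {A B : ℝ} (hA : 0 ≤ A)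
    (hB : 0 ≤ B) (hg : ∀ z, ‖g z‖ ≤ A * Real.exp (B * ‖z‖)) {p : ℝ} (hp : 0 < p) {t₁ t₂ : ℝ}
    (ht : t₁ ≤ t₂) {u : ℂ → ℝ} (hu : ∀ z, u z = ∫ t in t₁..t₂, ‖g (z + t)‖ ^ p) {M : ℝ}
    (hM : ∀ x : ℝ, u x ≤ M) (h0 : Tendsto (fun y : ℝ => u (y * I)) atTop (𝓝 0)) {y : ℝ}
    (hy : 0 ≤ y) : u (y * I) ≤ M := by
  -- the functional is continuous and has the sub-mean-value property
  have hHc : Continuous (Function.uncurry fun (z : ℂ) (t : ℝ) => g (z + t)) :=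
    hgd.continuous.comp (continuous_fst.add (continuous_ofReal.comp continuous_snd))
  have huc : Continuous u := by
    have := continuous_ppFun hHc hp t₁ t₂
    simpa [← hu] using this
  have husub : ∀ w : ℂ, ∀ r : ℝ, 0 < r → u w ≤ circleAverage u w r := fun w r hr =>
    ppFun_le_circleAverage hHc (fun t => hgd.comp (differentiable_id.add_const _)) hp ht hu w hr
  have hu0 : ∀ w, 0 ≤ u w := fun w => by
    rw [hu]; exact intervalIntegral.integral_nonneg ht fun t _ => by positivity
  have hM0 : u 0 ≤ M := by simpa using hM 0
  by_contra! hlt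
  set φ : ℝ → ℝ := fun s => u (s * I) with hφ
  have hφc : Continuous φ := huc.comp (continuous_ofReal.mul continuous_const)
  have hφ0 : φ 0 = u 0 := by simp [hφ]
  have hypos : 0 < y := lt_of_le_of_ne hy fun h => by
    rw [← h] at hlt
    have : φ 0 ≤ M := hφ0 ▸ hM0
    exact absurd (this.trans_lt hlt) (lt_irrefl _)
  -- eventually `φ < φ y`
  obtain ⟨Y, hY⟩ : ∃ Y, ∀ s ≥ Y, φ s < φ y :=
    eventually_atTop.1 (h0.eventually (gt_mem_nhds ((hu0 0).trans_lt (hM0.trans_lt hlt))))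
  have hyY : y < Y := lt_of_not_ge fun h => lt_irrefl _ (hY y h)
  have hY0 : 0 ≤ Y := hy.trans hyY.le
  obtain ⟨y₀, hy₀, hmax⟩ := isCompact_Icc.exists_isMaxOn (nonempty_Icc.2 hY0) hφc.continuousOn
  have hyy₀ : φ y ≤ φ y₀ := isMaxOn_iff.1 hmax y ⟨hy, hyY.le⟩
  have hall : ∀ s, 0 ≤ s → φ s ≤ φ y₀ := by
    intro s hs
    rcases le_or_gt s Y with h | h
    · exact isMaxOn_iff.1 hmax s ⟨hs, h⟩
    · exact ((hY s h.le).trans_le hyy₀).le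
  have hlt' : M < φ y := hlt
  have hreal : ∀ x : ℝ, u x ≤ φ y₀ := fun x => (hM x).trans (hlt'.le.trans hyy₀)
  -- Lemma 1 on the closed upper half-plane
  have hUHP : ∀ w : ℂ, 0 ≤ w.im → u w ≤ φ y₀ := fun w hw =>
    upperHalfPlane_ppFun hgd hA hB hg hp ht hu hreal (fun s hs => hall s hs) hw
  -- `y₀ > 0`
  have hy₀pos : 0 < y₀ := by
    rcases eq_or_lt_of_le hy₀.1 with h | h
    · exfalso
      have : φ y₀ ≤ M := by rw [← h, hφ0]; exact hM0
      exact absurd (hlt'.trans_le (hyy₀.trans this)) (lt_irrefl _)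
    · exact h
  -- strong maximum principle on the open upper half-plane
  have hV : IsOpen {w : ℂ | 0 < w.im} := isOpen_lt continuous_const continuous_im
  have hVc : IsPreconnected {w : ℂ | 0 < w.im} := (convex_halfSpace_im_gt 0).isPreconnected
  have hc₀ : (y₀ : ℂ) * I ∈ {w : ℂ | 0 < w.im} := by simpa using hy₀pos
  have hmax' : IsMaxOn u {w : ℂ | 0 < w.im} ((y₀ : ℂ) * I) :=
    isMaxOn_iff.2 fun w hw => hUHP w (le_of_lt hw)
  have hconst := eqOn_of_isMaxOn_of_le_circleAverage huc husub hV hVc hc₀ hmax'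
  -- contradiction at `s = Y`
  have hYmem : (Y : ℂ) * I ∈ {w : ℂ | 0 < w.im} := by simpa using hypos.trans hyY
  have h1 : φ Y = φ y₀ := hconst hYmem
  exact absurd h1 (ne_of_lt ((hY Y le_rfl).trans_le hyy₀))

end PlancherelPolya

end Literature.Analysis.Complex
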